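import Summits.ValiantsHypothesis.ValiantsHypothesis.Theorems.BarrierLeverPartitionMinorsHitByVPBlockContiguous
import Summits.ValiantsHypothesis.ValiantsHypothesis.Theorems.BarrierLeverPartitionMinorsBlockVandermondeResidue

/-!
# Route BarrierLever — item `PartitionMinorsHitByVP` (stmt-ValiantsHypothesis-19717):
# BLOCK-RESIDUE certificates — min-stratified rows × columns in `p`-adic windows are hit

Helper file (`--supports stmt-ValiantsHypothesis-19717`; cell valiant-natproofs, rung V4, 𝒟-side door (c),
prover seat val-np-p1, gen 11). Closes NO item; definition-free. The `p`-adic relaxation of the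
block-contiguous certificate (`…HitByVPBlockContiguous`): same Frobenius table, same row labels
`ℓ i = min_{a ∈ u i} π a` and column weights `D j = Σ_{c ∈ w j \ Z} p^{e c}`, same cross-class rule
(`ℓ i < ℓ i' ⇒ D (β i') < D (β i)`), but INSIDE a label class of size `g` it now suffices that
`g ≤ p^s` and the weights `D (β ·)` occupy `g` CYCLICALLY CONSECUTIVE residues modulo `p^s`
(`(D + p^s − A mod p^s) mod p^s ∈ [0, g)`, pairwise distinct; `s, A` chosen per class; for `g = p^s`:
weights pairwise distinct mod `p^s`). For `p = 2` a class of size `2` only needs two weights of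
different PARITY (the contiguous form needed weights differing by exactly `1`). The algebra is
`BlockVandermonde.det_pow_ne_zero_of_residues` (`(1+X)^{p^s} = 1 + X^{p^s}` makes the Taylor block see only
`D mod p^s`).

* `det_additiveZ_ne_zero_of_blockResidue` — the `ι`-indexed LEAF for engine v4 (`…AdditiveSplit`);
* `partitionMinor_hit_of_blockResidue` (+ `_rows` mirror) — the hit in `SmallCircuits ℂ (h+h) 5`, `h ≥ 2`;
* a concrete `example` checked by `decide`: rows `{0},{0,2},{1},{1,2}` × columns of weights `7,4,3,0`
  (runs replaced by parities), not block-contiguous.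

WHAT THIS IS NOT: still a skeleton of the Frobenius table's true reach; item 19717 stays open; nothing on CPM
(20172/20195), crux 14610 or VP vs VNP.
-/

set_option linter.dupNamespace false

namespace Summit.ValiantsHypothesis.ValiantsHypothesis.Theorems.BarrierLever.SubsetSum

open Finset MvPolynomial Literature.Barriers.ValiantsHypothesis
open Summit.ValiantsHypothesis.ValiantsHypothesis.Theorems.BarrierLever.AdditiveDoor
  (partitionMinor_hit_of_additive_mem partitionMinor_hit_symm)
open Summit.ValiantsHypothesis.ValiantsHypothesis.Theorems.BarrierLever.BlockVandermonde
  (det_pow_ne_zero_of_residues)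

noncomputable section

variable {h : ℕ}

/-- **BLOCK-RESIDUE CERTIFICATE ⇒ the integer additive matrix is nonsingular** (`ι`-indexed). Data as in
`det_additiveZ_ne_zero_of_blockContiguous` plus per-row window data `s, A : ι → ℕ` (used at one representative
per label class): class size `≤ p^{s i}`, shifted residues `(D (β i') + p^{s i} − A i mod p^{s i}) mod p^{s i}`
of the classmates `i'` below the class size and pairwise distinct. -/
theorem det_additiveZ_ne_zero_of_blockResidue (p : ℕ) [Fact p.Prime] {ι : Type*} [Fintype ι]
    [DecidableEq ι] (u w : ι → Finset (Fin h)) (hu : Function.Injective u) (hne : ∀ i, (u i).Nonempty)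
    (Z : Finset (Fin h)) (e : Fin h → ℕ) (π : Fin h → ℕ) (hπ : Function.Injective π)
    (D : ι → ℕ) (hw : ∀ j, ∑ c ∈ w j \ Z, p ^ e c = D j)
    (ℓ : ι → ℕ) (hℓ : ∀ i, (u i).inf' (hne i) π = ℓ i) (β : ι ≃ ι) (hD : Function.Injective D)
    (hlt : ∀ i i', ℓ i < ℓ i' → D (β i') < D (β i)) (s A : ι → ℕ)
    (hg : ∀ i, Fintype.card {k // ℓ k = ℓ i} ≤ p ^ s i)
    (hwin : ∀ i i', ℓ i' = ℓ i →
      (D (β i') + (p ^ s i - A i % p ^ s i)) % p ^ s i < Fintype.card {k // ℓ k = ℓ i})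
    (hinj : ∀ i i' i'', ℓ i' = ℓ i → ℓ i'' = ℓ i →
      (D (β i') + (p ^ s i - A i % p ^ s i)) % p ^ s i =
        (D (β i'') + (p ^ s i - A i % p ^ s i)) % p ^ s i → i' = i'') :
    (Matrix.of fun i j : ι =>
      (∏ c ∈ w j, (X (c, none) + ∑ a ∈ u i, X (c, some a)) :
        MvPolynomial (Fin h × Option (Fin h)) ℤ)).det ≠ 0 := by
  let ψ : MvPolynomial (Fin h × Option (Fin h)) ℤ →+* Polynomial (ZMod p) :=
    eval₂Hom (Int.castRingHom (Polynomial (ZMod p)))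
      (fun q : Fin h × Option (Fin h) =>
        Option.elim q.2 (if q.1 ∈ Z then 1 else 0) fun a =>
          if q.1 ∈ Z then 0 else (Polynomial.X : Polynomial (ZMod p)) ^ ((π a + 1) * p ^ e q.1))
  let ξ : Finset (Fin h) → Polynomial (ZMod p) := fun U =>
    ∑ b ∈ U, (Polynomial.X : Polynomial (ZMod p)) ^ (π b + 1)
  let ρ : ι → Polynomial (ZMod p) := fun i =>
    ∑ b ∈ (u i).filter (fun b => π b ≠ ℓ i), (Polynomial.X : Polynomial (ZMod p)) ^ (π b - ℓ i - 1)
  have hξ : ∀ i, ξ (u i) = Polynomial.X ^ (ℓ i + 1) * (1 + Polynomial.X * ρ i) := fun i =>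
    codePolyL_eq π hπ (u i) (hne i) (ℓ i) (hℓ i)
  set M : Matrix ι ι (MvPolynomial (Fin h × Option (Fin h)) ℤ) := Matrix.of fun i j : ι =>
      (∏ c ∈ w j, (X (c, none) + ∑ a ∈ u i, X (c, some a)) :
        MvPolynomial (Fin h × Option (Fin h)) ℤ) with hM
  have hmat : (ψ.mapMatrix M).submatrix id β =
      Matrix.of fun i j : ι =>
        (Polynomial.X ^ (ℓ i + 1) * (1 + Polynomial.X * ρ i)) ^ (D (β j)) := by
    refine Matrix.ext fun i j => ?_
    rw [Matrix.submatrix_apply, RingHom.mapMatrix_apply, Matrix.map_apply, hM, Matrix.of_apply,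
      Matrix.of_apply, id, ← hξ i, ← hw (β j)]
    exact frobL_entry Z e π (u i) (w (β j))
  have hcl : ∀ i, Fintype.card {k // ℓ k + 1 = ℓ i + 1} = Fintype.card {k // ℓ k = ℓ i} := fun i =>
    Fintype.card_congr (Equiv.subtypeEquivRight fun k => by omega)
  have hblock : (Matrix.of fun i j : ι =>
      (Polynomial.X ^ (ℓ i + 1) * (1 + Polynomial.X * ρ i)) ^ (D (β j))).det ≠ 0 := by
    refine det_pow_ne_zero_of_residues (ZMod p) p (fun i => ℓ i + 1) ρ (fun j => D (β j)) s A
      (fun i => Nat.succ_pos _) (fun i i' h1 h2 => ?_) (hD.comp β.injective) (fun i i' h => ?_)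
      (fun i => ?_) (fun i i' h => ?_) (fun i i' i'' h' h'' hres => ?_)
    · apply hu
      apply codePolyL_injective (p := p) π hπ
      show ξ (u i) = ξ (u i')
      rw [hξ i, hξ i', h2]
      congr 1
      rw [show ℓ i = ℓ i' by omega]
    · exact hlt i i' (by omega)
    · rw [hcl i]
      exact hg i
    · rw [hcl i]
      exact hwin i i' (by omega)
    · exact hinj i i' i'' (by omega) (by omega) hres
  rw [← hmat] at hblock
  have hdetψ : (ψ.mapMatrix M).det ≠ 0 := det_ne_zero_of_submatrix _ (Equiv.refl ι) β hblock
  intro h0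
  apply hdetψ
  rw [← RingHom.map_det, h0, map_zero]

/-- **MIN-STRATIFIED rows × BLOCK-RESIDUE columns are hit** (`ι`-indexed, `h ≥ 2`, `b = 5`). -/
theorem partitionMinor_hit_of_blockResidue (hh : 2 ≤ h) (p : ℕ) [Fact p.Prime] {ι : Type*}
    [Fintype ι] [DecidableEq ι] (u w : ι → Finset (Fin h)) (hu : Function.Injective u)
    (hne : ∀ i, (u i).Nonempty) (Z : Finset (Fin h)) (e : Fin h → ℕ) (π : Fin h → ℕ)
    (hπ : Function.Injective π) (D : ι → ℕ) (hw : ∀ j, ∑ c ∈ w j \ Z, p ^ e c = D j)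
    (ℓ : ι → ℕ) (hℓ : ∀ i, (u i).inf' (hne i) π = ℓ i) (β : ι ≃ ι) (hD : Function.Injective D)
    (hlt : ∀ i i', ℓ i < ℓ i' → D (β i') < D (β i)) (s A : ι → ℕ)
    (hg : ∀ i, Fintype.card {k // ℓ k = ℓ i} ≤ p ^ s i)
    (hwin : ∀ i i', ℓ i' = ℓ i →
      (D (β i') + (p ^ s i - A i % p ^ s i)) % p ^ s i < Fintype.card {k // ℓ k = ℓ i})
    (hinj : ∀ i i' i'', ℓ i' = ℓ i → ℓ i'' = ℓ i →
      (D (β i') + (p ^ s i - A i % p ^ s i)) % p ^ s i =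
        (D (β i'') + (p ^ s i - A i % p ^ s i)) % p ^ s i → i' = i'') :
    ∃ f ∈ SmallCircuits ℂ (h + h) 5,
      (Matrix.of fun i j : ι => MvPolynomial.coeff
        (∑ a ∈ u i, Finsupp.single (Fin.castAdd h a) 1 +
          ∑ c ∈ w j, Finsupp.single (Fin.natAdd h c) 1) f).det ≠ 0 :=
  partitionMinor_hit_of_det_additiveZ_ne_zero hh u w
    (det_additiveZ_ne_zero_of_blockResidue p u w hu hne Z e π hπ D hw ℓ hℓ β hD hlt s A hg hwin hinj)

/-- **BLOCK-RESIDUE rows × MIN-STRATIFIED columns are hit** (`x ↔ y` mirror, `Fin r` indexing). -/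
theorem partitionMinor_hit_of_blockResidue_rows (hh : 2 ≤ h) (p : ℕ) [Fact p.Prime] {r : ℕ}
    (u w : Fin r → Finset (Fin h)) (hw : Function.Injective w) (hne : ∀ j, (w j).Nonempty)
    (Z : Finset (Fin h)) (e : Fin h → ℕ) (π : Fin h → ℕ) (hπ : Function.Injective π)
    (D : Fin r → ℕ) (hu : ∀ i, ∑ c ∈ u i \ Z, p ^ e c = D i)
    (ℓ : Fin r → ℕ) (hℓ : ∀ j, (w j).inf' (hne j) π = ℓ j) (β : Equiv.Perm (Fin r))
    (hD : Function.Injective D) (hlt : ∀ j j', ℓ j < ℓ j' → D (β j') < D (β j)) (s A : Fin r → ℕ)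
    (hg : ∀ j, Fintype.card {k // ℓ k = ℓ j} ≤ p ^ s j)
    (hwin : ∀ j j', ℓ j' = ℓ j →
      (D (β j') + (p ^ s j - A j % p ^ s j)) % p ^ s j < Fintype.card {k // ℓ k = ℓ j})
    (hinj : ∀ j j' j'', ℓ j' = ℓ j → ℓ j'' = ℓ j →
      (D (β j') + (p ^ s j - A j % p ^ s j)) % p ^ s j =
        (D (β j'') + (p ^ s j - A j % p ^ s j)) % p ^ s j → j' = j'') :
    ∃ f ∈ SmallCircuits ℂ (h + h) 5,
      (Matrix.of fun i j : Fin r => MvPolynomial.coeff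
        (∑ a ∈ u i, Finsupp.single (Fin.castAdd h a) 1 +
          ∑ c ∈ w j, Finsupp.single (Fin.natAdd h c) 1) f).det ≠ 0 :=
  partitionMinor_hit_symm h 5 u w
    (partitionMinor_hit_of_blockResidue hh p w u hw hne Z e π hπ D hu ℓ hℓ β hD hlt s A hg hwin hinj)

/-- Smoke test by `decide` (`h = 3`, `p = 2`, `e c = 2 − c`, `π = id`, `β = id`, `s = 1`, `A = 0`): rows
`{0},{0,2},{1},{1,2}` (labels `0,0,1,1`) × columns `{0,1,2},{0},{1,2},∅` of weights `7,4,3,0` — two classes of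
size `2 = 2^1`, weights of different parity inside each class; NOT block-contiguous (`7,4` is not a run). -/
example : ∃ f ∈ SmallCircuits ℂ (3 + 3) 5,
    (Matrix.of fun i j : Fin 4 => MvPolynomial.coeff
      (∑ a ∈ (![{0}, {0, 2}, {1}, {1, 2}] : Fin 4 → Finset (Fin 3)) i, Finsupp.single (Fin.castAdd 3 a) 1 +
        ∑ c ∈ (![{0, 1, 2}, {0}, {1, 2}, ∅] : Fin 4 → Finset (Fin 3)) j,
          Finsupp.single (Fin.natAdd 3 c) 1) f).det ≠ 0 :=
  have : Fact (Nat.Prime 2) := ⟨Nat.prime_two⟩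
  partitionMinor_hit_of_blockResidue (h := 3) (by norm_num) 2
    (![{0}, {0, 2}, {1}, {1, 2}]) (![{0, 1, 2}, {0}, {1, 2}, ∅]) (by decide) (by decide)
    ∅ (fun c => 2 - (c : ℕ)) (fun c => (c : ℕ)) Fin.val_injective ![7, 4, 3, 0] (by decide)
    ![0, 0, 1, 1] (by decide) (Equiv.refl _) (by decide) (by decide) (fun _ => 1) (fun _ => 0)
    (by decide) (by decide) (by decide)

end

end Summit.ValiantsHypothesis.ValiantsHypothesis.Theorems.BarrierLever.SubsetSum
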